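import Literature.MathematicalPhysics.QuantumFieldTheory.Balaban1983to89.B9Cor36GCubeLocDefectTransfer
import Literature.MathematicalPhysics.QuantumFieldTheory.Balaban1983to89.B9Cor36CubeTwinsGeometry
import Literature.MathematicalPhysics.QuantumFieldTheory.Balaban1983to89.B9Thm39CinvSepMiddle

/-!
# `Balaban1983to89.B9Cor36GCubeLocDefectCore` — THE CUBE-SIDE [4]-(2.51) MAJORANTS OF THE DEFECT CORES `DP_□D*(Ṽ)·(M_{χ_□} − 1)·G_□(Ṽ)` AND
# `G_□(Ṽ)·(M_{χ_□} − 1)·DP_□D*(Ṽ)` OF THE BOND-SECTOR CUBE LETTER WITH THE SEPARATION `e^{−a·δ₀·M_h}` ON THE ROWS MEETING `supp h_□`, AND THE MEMBER-SIDE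
# MAJORANTS OF `conj b(E_□)`, `conj b(E♯_□)` THEY GIVE THROUGH D1 (sub-row G-B9-LETTERS, module M5.1b-G item 2 «defect majorants `locDefectBY ∕ locDefectTBY`»,
# programme DEFECT-R, FILE D2; design (R) term, NOT in print)

statement-level skeleton of published theorems with citation tags; proofs where landed; nothing here is a claim about the Yang–Mills mass gap

THE PRINTED LOCUS (verbatim, held `paper:balaban1985-cmp99-background-propagators`, journal page = PDF page + 388).  p. 411 l. 12–14: «the supports of h_□ and
of 1 − □̃ are separated at least by a distance MLʲη, hence using the estimates (3.42), (3.48) for the operators … we get the bound with the exponential factor»;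
p. 412 l. 31–36 («… exp(−δ₀M) … is sufficiently small»); (3.105) p. 414 («T = Σ_□ h_□ … h_□», «|T| ≦ ½» by the same separation); (3.87) p. 409; Cor. 3.6 p. 408
l. 3–14; p. 409 l. 1–5 («the operators constructed for this sequence … satisfy all the inequalities of Theorems 3.1–3.3»).  [4] (2.83)–(2.85) pp. 237–238 (the model
estimate: a product `A·(1 − χ)·B` of two exponentially localized kernels whose outer variable is confined near □ and whose middle cut-off lives at distance `≧ D`
from it is `≦ const·e^{−aD}·e^{−ρd}`), (2.51)–(2.55) p. 232, Lemma 2.1 (2.61) p. 234, (2.36) p. 229, (2.46) p. 231.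

WHY THIS FILE.  D1 `B9Cor36GCubeLocDefectTransfer` (p669596 ✓) reduced the member-side majorants of the two defect letters of G-F2's local-inverse laws,
`E_□ = M_h·R(u)⁻¹·[DP_□D*(Ṽ)·(M_χ − 1)·G_□(Ṽ)]·R(u)·M_h` and `E♯_□` (core reversed), to ONE cube-side block majorant `K_C` of the realified core each, needed only
on the rows meeting `supp h_□` (`hcmp`).  THIS FILE produces `K_C`: the core is `conj b(DP_□D*)·mulOp(χ_□ − 1)·GVK` (§1), the middle cut-off `χ_□ − 1` vanishes
on the blocks of p21's `N_□ = nearN i □` (`chiY_eq_one_of_not_mem_sdiff`), a row block holding a site of `supp h_□` is at `d_□`-distance `≧ M_h` from every block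
outside `N_□` (§2, p21's `sub_le_dist_mul_of_nearC` argument with the site given), so r05∕p21's separated-middle engine `B9Thm39CinvSepMiddle.sepMiddle_majorant_blk`
([4] (2.83)) gives `𝟙_{S}(a)·κ·e^{−a_sep·δ₀·M_h}·e^{−ρδ₀d_□}` on those rows and its unseparated twin `sepMiddle_majorant_blk₀` the flat `κ·e^{−ρδ₀d_□}` on the others
(§3); §4 feeds the result to D1 and lands on the member's geometry.  The two operator inputs are DISPLAYED in the engine's shape: `hP` — a block majorant
`K_P·ℓ_□(a)⁻²·e^{−a_P·δ₀·d_□}` of `conj b(DP_□D*(Ṽ))` (layer D2a: from the landed `G′_□(Ṽ_□)`, `Q′`, `C_□` letters; r06 FILE 27 `B9Thm34RFinal` is the site-level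
precedent) — and `hG` — `B_G·ℓ_□(y)²·e^{−b_G·δ₀·d_□}` for `GVK(Ṽ)` (G-F7 v1.1 `cor36_G_cube_at_locCfg'`, transferred flat entry, at `Ṽ = Ṽ_□`); the weights cancel
(`ℓ⁻²·ℓ² = 1`), so both member-side kernels are FLAT — the currency of the 4th families of M5.7's `hrest` (and, after one member-side scale transfer, `hV'`).

WHAT THIS FILE CERTIFIES (kernel-checked; 0 `def`, 0 `def … : Prop`, 0 sorry; standard axioms only)

* §1 `cutMulY_sub_one`, `conj_core_E_eq` ∕ `conj_core_ET_eq` (the realified cores as `conj b(DP_□D*)·mulOp(χ_□ − 1)·GVK` and reversed), `mulOp_add_eq_one`,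
  `abs_chi_sub_one_le_one`, `chi_sub_one_eq_zero_of_not_mem_sdiff`.
* §2 ★ `Mh_le_dist_of_hTY_ne_zero` — `h_□(z) ≠ 0`, `y ∉ N_□` ⟹ `M_h ≦ d_□(blk z, y)` (p. 411 l. 12–14 for the site-level `h_□`).
* §3 ★★ `hasMajorant_core_E` ∕ ★★ `hasMajorant_core_ET` — GIVEN `hP`, `hG`, (2.61) at `b − ρ`, the scale transfer of `ℓ²` (resp. `ℓ⁻²`) at `α_st`, and
  `α_st + a_sep + ρ ≦ a_L`: the realified core `≺ (if the row block meets supp h_□ then K_PB_GΛc₁·e^{−a_sep·δ₀·M_h} else K_PB_GΛc₁)·e^{−ρδ₀d_□(a,b′)}` over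
  `(toB6 (geoCK i □) Rr H, blkBK i □)`.
* §4 ★★★ `hasMajorant_conj_locDefectBY` ∕ ★★★ `hasMajorant_conj_locDefectTBY` — the same data and a bi-contractive gauge `u` ⟹
  `conj b(E_□) ≺ (M₂Σ‖b_j‖)²·𝟙_□(a)·(K_PB_GΛc₁·e^{−a_sep·δ₀·M_h})·e^{−ρδ₀·d(a,a′)}` over the MEMBER's `(toB6 (geo9K i) Rr′ Hp, ιB∘blkV1)` (resp. `E♯_□`), `𝟙_□(a)` the
  row indicator «block `a` holds a bond whose cube block meets `supp h_□`» (for D3's `hasMajorant_localSum`): M5.1b-G item 2 per cube, modulo `hP` (D2a) and the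
  cover sum (D3).

HONEST SCOPE ∕ NOT CLAIMED.  (i) `E_□`, `E♯_□` are the (R)-DESIGN TERMS of G-F2's laws (print's (3.105) `T` is the analogous sum for the three-factor formula; nothing
printed fails).  (ii) DISPLAYED, not proved here: `hP` (layer D2a), `hG` (G-F7 at `Ṽ_□`; any `Ṽ` here), (2.61) and the two scale transfers of the cube geometry (p33
`exists_h261_geoCK` ∕ `hST_geoCK` above the member thresholds), the numerical side conditions, the bi-contractive gauge.  (iii) NOT here: the sum over the cubes of a
member with the multiplicity of the cover and the smallness bookkeeping `e^{−a_sep·δ₀·M_h} ≦ …` against M5.7's `Θ′` (FILE D3), the `ℓ(a)·ℓ(a′)⁻¹` weight of `hV'`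
(D3, one member-side scale transfer), the ζ-words of (3.105) (families 1–3 of `hrest`; r06's R-Ker series).  Count-neutral; NOT a node discharge; no summit ∕
sub-problem statement is proved; nothing continuum ∕ OS ∕ mass-gap ∕ Clay; YM mass gap NOT proved (Track A conditional rung).  No `sorry`, no `axiom`, no `… : Prop`
fact, no `instance`, no `notation`, no `def`.  NEW file; nothing landed is modified.  Cell `lit-balaban`, seat `lit-balaban-p33` gen 102, 2026-08-28;
`--supports stmt-QuantumFields-19200` as helper.  Net new unproved facts: 0.

RELATED IN THE TREE, NOT DUPLICATED (searched 2026-08-28: `rg 'sepMiddle_majorant'` = p21 `B9Cor36CinvCubeLocDefectCore(Hom)` (C-letter cores on the block∕site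
carriers with `Q′_□` sandwiches — a different word and carrier); `rg 'locDefectBY'` majorants = ∅): D1 `B9Cor36GCubeLocDefectTransfer`, p21 `B9Cor36CubeTwinsGeometry`
(`nearN`, `sub_le_dist_mul_of_nearC`, `chiY_eq_one_of_not_mem_sdiff`, `Mh_le_dist_of_mem_twinS` — the block-representative version of §2), r05∕p21
`B9Thm39CinvSepMiddle`, r06 `B9Thm39CinvTorusRegular.conj_cutMulY`, p38 `B9Cor36SiteSandwichTransfer.dist_member_le_dist_cube` — all USED BY NAME.
-/

noncomputable section

namespace Literature.MathematicalPhysics.QuantumFieldTheory.Balaban1983to89.B9Cor36GCubeLocDefectCore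

open B6RandomWalk (HasMajorant hasMajorant_mono hasMajorant_add Ineq261 c1_nonneg)
open B9Thm34Ext (toB6)
open B9Thm37Sum (mulOp mulOp_apply)
open B9Ineq347 (ScaleTransfer)
open B9Eq352DivFormLetters (conj)
open B6KLevelCensusIndexV1 (KIdx)
open B6Cover236MultiLevelBlocks (cubes)
open B6GlobalChartV1 (blkV1)
open B6Geom246MultiLevelBox (blkOf)
open B6Ineq2142KLevelV1 (β)
open B9GeoNormsKLevelV1 (geo9K)
open B4TorusKernel.MultiPeriod (circAbs torusSupNorm)
open B9Thm37CubeCoverCommutators (cutMulY cutMulY_apply hTY hTY_apply)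
open B9Thm37CubeCoverCommutatorSizes (side_conditions)
open B9Thm39CinvTorusRegular (conj_cutMulY)
open B9Thm39CinvSepMiddle (sepMiddle_majorant_blk sepMiddle_majorant_blk₀)
open B9Eq3104CutoffCommutators (hBdY hBdY_apply)
open B9Eq3105AtLetters (DPDsCubeY)
open B9CubeLettersBondOpsL0 (BlkCubeY blkCornerCubeY GACubeY)
open B9Eq360DeltaPrimeACubeY (blkCubeY)
open B9CubeGeometryInputs (geoCK geoCK_len_pos geoCK_dist_axioms)
open B9Cor35GCubeInputsAtOne (blkBK GVK)
open B9Cor36CubeCutoffs (SC NearC chiY nearC_of_hT_ne_zero)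
open B9Cor36CubeTwinsGeometry (bS nearN mem_nearN SC_eq one_le_bS blkCubeY_corner sub_le_dist_mul_of_nearC chiY_eq_one_of_not_mem_sdiff chiY_nonneg_le_one
  torusSupNorm_le_dist_posT_add dist_posT_le_dist_mul)
open B9Cor36GCubeLocLetter (locDefectBY locDefectTBY)
open B9Cor36GCubeLocDefectTransfer (hasMajorant_conj_locDefectBY_of_core hasMajorant_conj_locDefectTBY_of_core)
open B9Cor36SiteSandwichTransfer (dist_member_le_dist_cube)
open Node00 (SiteY BlkY IBondY FBondY CfgY GaugeY SiteParY BondParY toKT)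
open Node00.OpsYNablaBridge (chartY)

variable {d ℓ : ℕ} {hd : 1 ≤ d + 1} {hL : Odd (ℓ + 1) ∧ 1 < ℓ + 1} {b₀ b₁ : ℝ}
variable {𝔸 : Type} [NormedRing 𝔸] [NormedAlgebra ℂ 𝔸] [CompleteSpace 𝔸]
variable {ι : Type} [Fintype ι]

/-! ## §1  The realified cores as `conj b(DP_□D*)·mulOp(χ_□ − 1)·GVK` (and reversed); the row split `mulOp f + mulOp (1 − f) = 1` -/

section Algebra

variable (i : KIdx d ℓ hd hL b₀ b₁) (c : ↥(cubes (toKT i).D.toDomains)) (parS : SiteParY 𝔸 i) (parB : BondParY 𝔸 i) (b : Module.Basis ι ℝ 𝔸)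

omit [CompleteSpace 𝔸] in
/-- `M_χ − 1 = M_{χ−1}` for the real bond cut-offs of record. [cite: Balaban1985BackgroundPropagators, (3.87) p.409, bookkeeping] -/
theorem cutMulY_sub_one (χ : SiteY i → ℝ) :
    (cutMulY (𝔸 := 𝔸) (hBdY i χ) - 1 : (FBondY i → 𝔸) →ₗ[ℂ] (FBondY i → 𝔸)) = cutMulY (𝔸 := 𝔸) (hBdY i fun z => χ z - 1) := by
  refine LinearMap.ext fun v => funext fun f => ?_
  rw [LinearMap.sub_apply, Pi.sub_apply, cutMulY_apply, cutMulY_apply, hBdY_apply, hBdY_apply, Module.End.one_apply, Complex.ofReal_sub,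
    Complex.ofReal_one, sub_smul, one_smul]

/-- ★ the realified core of `E_□` is `conj b(DP_□D*(Ṽ))·mulOp(χ_□ − 1)·GVK(Ṽ)` in the real coordinates of the basis `b` (r06's `conj_cutMulY`; G-F5's `GVK`).
[cite: Balaban1985BackgroundPropagators, (3.105) p.414, (3.87) p.409; Balaban1984PropagatorsII, (2.52)–(2.55) p.232] -/
theorem conj_core_E_eq (χ : SiteY i → ℝ) (V : CfgY 𝔸 i) :
    conj b ((DPDsCubeY i c parS V * (cutMulY (𝔸 := 𝔸) (hBdY i χ) - 1) * GACubeY i c parS parB V).restrictScalars ℝ) =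
      conj b ((DPDsCubeY i c parS V).restrictScalars ℝ) * mulOp (fun p : FBondY i × ι => hBdY i χ p.1 - 1) * GVK b i c parS parB V := by
  have hsplit : ((DPDsCubeY i c parS V * (cutMulY (𝔸 := 𝔸) (hBdY i χ) - 1) * GACubeY i c parS parB V).restrictScalars ℝ :
      Module.End ℝ (FBondY i → 𝔸)) =
      (DPDsCubeY i c parS V).restrictScalars ℝ * ((cutMulY (𝔸 := 𝔸) (hBdY i fun z => χ z - 1)).restrictScalars ℝ) *
        (GACubeY i c parS parB V).restrictScalars ℝ := by
    rw [cutMulY_sub_one]; exact LinearMap.ext fun _ => rfl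
  rw [hsplit, B9Eq352DivFormLetters.conj_mul, B9Eq352DivFormLetters.conj_mul, conj_cutMulY]
  rfl

/-- ★ the realified core of `E♯_□` is `GVK(Ṽ)·mulOp(χ_□ − 1)·conj b(DP_□D*(Ṽ))`. [cite: Balaban1985BackgroundPropagators, (3.105) p.414, (3.87) p.409; Balaban1984PropagatorsII, (2.52)–(2.55) p.232] -/
theorem conj_core_ET_eq (χ : SiteY i → ℝ) (V : CfgY 𝔸 i) :
    conj b ((GACubeY i c parS parB V * (cutMulY (𝔸 := 𝔸) (hBdY i χ) - 1) * DPDsCubeY i c parS V).restrictScalars ℝ) =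
      GVK b i c parS parB V * mulOp (fun p : FBondY i × ι => hBdY i χ p.1 - 1) * conj b ((DPDsCubeY i c parS V).restrictScalars ℝ) := by
  have hsplit : ((GACubeY i c parS parB V * (cutMulY (𝔸 := 𝔸) (hBdY i χ) - 1) * DPDsCubeY i c parS V).restrictScalars ℝ :
      Module.End ℝ (FBondY i → 𝔸)) =
      (GACubeY i c parS parB V).restrictScalars ℝ * ((cutMulY (𝔸 := 𝔸) (hBdY i fun z => χ z - 1)).restrictScalars ℝ) *
        (DPDsCubeY i c parS V).restrictScalars ℝ := by
    rw [cutMulY_sub_one]; exact LinearMap.ext fun _ => rfl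
  rw [hsplit, B9Eq352DivFormLetters.conj_mul, B9Eq352DivFormLetters.conj_mul, conj_cutMulY]
  rfl

end Algebra

/-- the row split: `mulOp f + mulOp (1 − f) = 1`. [cite: Balaban1984PropagatorsII, (2.79) p.237 («resolution of the identity»), bookkeeping] -/
theorem mulOp_add_eq_one {X : Type} (f : X → ℝ) : mulOp f + mulOp (fun x => 1 - f x) = (1 : Module.End ℝ (X → ℝ)) := by
  refine LinearMap.ext fun μ => funext fun x => ?_
  rw [LinearMap.add_apply, Pi.add_apply, mulOp_apply, mulOp_apply, Module.End.one_apply]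
  ring

/-! ## §2  The cut-offs on the cube sequence's blocks: `|χ_□ − 1| ≤ 1`, `χ_□ − 1 = 0` on `N_□`, and the separation `M_h ≤ d_□(supp h_□, ∁N_□)` -/

section Geometry

variable (i : KIdx d ℓ hd hL b₀ b₁) (c : ↥(cubes (toKT i).D.toDomains))

omit [Fintype ι] in
/-- `|χ_□(f₋) − 1| ≤ 1` (`0 ≤ χ_□ ≤ 1`). [cite: Balaban1985BackgroundPropagators, (3.87) p.409; Balaban1984PropagatorsII, (2.46) p.231, bookkeeping] -/
theorem abs_chi_sub_one_le_one (p : FBondY i × ι) : |hBdY i (chiY i c) p.1 - 1| ≤ 1 := by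
  rw [hBdY_apply]
  obtain ⟨h0, h1⟩ := chiY_nonneg_le_one i c (chartY i p.1.src)
  rw [abs_le]; constructor <;> linarith

omit [Fintype ι] in
/-- the middle cut-off `χ_□ − 1` VANISHES on the bonds of the blocks of `N_□` (`χ_□ = 1` there, p21's `chiY_eq_one_of_not_mem_sdiff`).
[cite: Balaban1985BackgroundPropagators, (3.87) p.409, p.411 l.12–14; Balaban1984PropagatorsII, (2.46) p.231] -/
theorem chi_sub_one_eq_zero_of_not_mem_sdiff (p : FBondY i × ι) (hp : blkBK i c p ∉ Finset.univ \ nearN i c) : hBdY i (chiY i c) p.1 - 1 = 0 := by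
  rw [hBdY_apply, chiY_eq_one_of_not_mem_sdiff i c (z := chartY i p.1.src) hp, sub_self]

/-- ★ **THE SEPARATION FOR THE SITE-LEVEL `h_□`**: if `h_□(z) ≠ 0` and `y ∉ N_□` then `M_h ≤ d_□(blk_□ z, y)` («the supports of h_□ and of 1 − □̃ are separated at
least by a distance MLʲη»; p21's `Mh_le_dist_of_mem_twinS` with the witnessing site given instead of the block representative — same arithmetic
`2M_h − 2 + 2L^{−(j+1)} ≤ d_□`). [cite: Balaban1985BackgroundPropagators, p.411 l.12–14, p.412 l.31–36; Balaban1984PropagatorsII, (2.83) p.237, (2.46) p.231, (2.36) p.229] -/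
theorem Mh_le_dist_of_hTY_ne_zero {z : SiteY i} {s y : BlkCubeY i c} (hs : blkCubeY i c z = s) (hz : hTY i c z ≠ 0) (hy : y ∉ nearN i c) :
    ((toKT i).Mh : ℝ) ≤ (geoCK i c).dist s y := by
  have h₁ : NearC i c (SC i c) z.1 := nearC_of_hT_ne_zero i c (by rwa [hTY_apply] at hz)
  have h₂ : ¬ NearC i c (3 * SC i c - (bS i c : ℤ)) (blkCornerCubeY i c y).1 := fun h => hy ((mem_nearN i c).2 h)
  have key := sub_le_dist_mul_of_nearC i c hs (blkCubeY_corner i c y) h₁ h₂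
  have eSC : ((SC i c : ℤ) : ℝ) = ((toKT i).Mh : ℝ) * ((bS i c : ℕ) : ℝ) := by
    rw [SC_eq]; push_cast; ring
  have hb : (1 : ℝ) ≤ ((bS i c : ℕ) : ℝ) := by exact_mod_cast one_le_bS i c
  have hMh : (2 : ℝ) ≤ ((toKT i).Mh : ℝ) := by exact_mod_cast (side_conditions i).2.1
  push_cast at key
  rw [eSC] at key
  by_contra hlt
  push Not at hlt
  nlinarith [mul_lt_mul_of_pos_right hlt (lt_of_lt_of_le one_pos hb)]

end Geometry

/-! ## §3  The cube-side majorants of the two cores ([4] (2.83) with the separation in the middle on the rows meeting `supp h_□`, flat elsewhere) -/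

section Core

variable (i : KIdx d ℓ hd hL b₀ b₁) (c : ↥(cubes (toKT i).D.toDomains)) (parS : SiteParY 𝔸 i) (parB : BondParY 𝔸 i) (b : Module.Basis ι ℝ 𝔸)

open Classical in
set_option maxHeartbeats 1600000 in
/-- ★★ **THE CUBE-SIDE MAJORANT OF THE CORE OF `E_□`.**  Let `conj b(DP_□D*(Ṽ)) ≺ K_P·ℓ_□(a)⁻²·e^{−a_P·δ₀·d_□}` (`hP`), `GVK(Ṽ) ≺ B_G·ℓ_□(y)²·e^{−b_G·δ₀·d_□}` (`hG`),
(2.61) hold at `b_G − ρ`, the scale transfer `e^{−α_st·δ₀·d_□(a,y)}ℓ_□(y)² ≦ Λ·ℓ_□(a)²` hold, and `α_st + a_sep + ρ ≦ a_P` (`a_sep, ρ, δ₀ ≧ 0`).  Then over the cube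
sequence's blocks `conj b(DP_□D*(Ṽ)·(M_{χ_□} − 1)·G_□(Ṽ)) ≺ (K_PB_GΛ·c₁(δ₀, b_G − ρ)·[e^{−a_sep·δ₀·M_h} if the row block holds a site of supp h_□, else 1])·e^{−ρδ₀d_□(a,b′)}`:
the rows meeting `supp h_□` see the middle cut-off only at distance `≧ M_h` (§2), the others are bounded flat; the weights `ℓ⁻²·ℓ²` cancel.
[cite: Balaban1985BackgroundPropagators, p.411 l.12–14, p.412 l.31–36, (3.105) p.414, (3.87) p.409, Cor. 3.6 p.408; Balaban1984PropagatorsII, (2.83)–(2.85) pp.237–238, (2.52)–(2.55) p.232, Lemma 2.1 (2.61) p.234] -/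
theorem hasMajorant_core_E (V : CfgY 𝔸 i) (Rr : ℝ) (H : Prop) (dB : ℕ) {δ₀ aP bG αst asep ρ KP BG Λ : ℝ}
    (hδ₀ : 0 ≤ δ₀) (hKP : 0 ≤ KP) (hBG : 0 ≤ BG) (hΛ : 0 ≤ Λ) (hasep : 0 ≤ asep) (hρ : 0 ≤ ρ) (hsplit : αst + asep + ρ ≤ aP)
    (h261 : Ineq261 dB (toB6 (geoCK i c) Rr H) δ₀ (bG - ρ)) (hST : ScaleTransfer (geoCK i c) δ₀ αst Λ (fun a => (geoCK i c).len a ^ 2))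
    (hP : HasMajorant (g := toB6 (geoCK i c) Rr H) (blkBK i c) (conj b ((DPDsCubeY i c parS V).restrictScalars ℝ))
      (fun a y => KP * ((geoCK i c).len a ^ 2)⁻¹ * Real.exp (-(aP * δ₀ * (geoCK i c).dist a y))))
    (hG : HasMajorant (g := toB6 (geoCK i c) Rr H) (blkBK i c) (GVK b i c parS parB V)
      (fun y b' => BG * (geoCK i c).len y ^ 2 * Real.exp (-(bG * δ₀ * (geoCK i c).dist y b')))) :
    HasMajorant (g := toB6 (geoCK i c) Rr H) (blkBK i c)
      (conj b ((DPDsCubeY i c parS V * (cutMulY (𝔸 := 𝔸) (hBdY i (chiY i c)) - 1) * GACubeY i c parS parB V).restrictScalars ℝ))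
      (fun a b' => (if ∃ z : SiteY i, blkCubeY i c z = a ∧ hTY i c z ≠ 0
          then KP * BG * Λ * B6.c1 dB δ₀ (bG - ρ) * Real.exp (-(asep * δ₀ * (toKT i).Mh)) else KP * BG * Λ * B6.c1 dB δ₀ (bG - ρ)) *
        Real.exp (-(ρ * δ₀ * (geoCK i c).dist a b'))) := by
  obtain ⟨hdnn, htri, -, hsymm⟩ := geoCK_dist_axioms i c Rr H
  have hℓ2 : ∀ a : BlkCubeY i c, 0 ≤ (geoCK i c).len a ^ 2 := fun a => sq_nonneg _
  have hℓ2i : ∀ a : BlkCubeY i c, 0 ≤ ((geoCK i c).len a ^ 2)⁻¹ := fun a => inv_nonneg.2 (hℓ2 a)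
  set Sf : Finset (BlkCubeY i c) := Finset.univ.filter fun s => ∃ z : SiteY i, blkCubeY i c z = s ∧ hTY i c z ≠ 0 with hSf
  have hmemSf : ∀ s, s ∈ Sf ↔ ∃ z : SiteY i, blkCubeY i c z = s ∧ hTY i c z ≠ 0 := fun s => by simp [hSf]
  set Sc : Finset (BlkCubeY i c) := Finset.univ.filter fun s => ¬ ∃ z : SiteY i, blkCubeY i c z = s ∧ hTY i c z ≠ 0 with hSc
  have hmemSc : ∀ s, s ∈ Sc ↔ ¬ ∃ z : SiteY i, blkCubeY i c z = s ∧ hTY i c z ≠ 0 := fun s => by simp [hSc]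
  set f : FBondY i × ι → ℝ := fun p => if blkBK i c p ∈ Sf then 1 else 0 with hf
  set m : FBondY i × ι → ℝ := fun p => hBdY i (chiY i c) p.1 - 1 with hm
  have hf1 : ∀ p, |f p| ≤ 1 := fun p => by simp only [hf]; split_ifs <;> norm_num
  have hf0 : ∀ p, blkBK i c p ∉ Sf → f p = 0 := fun p hp => by simp only [hf, if_neg hp]
  have hg1 : ∀ p, |1 - f p| ≤ 1 := fun p => by simp only [hf]; split_ifs <;> norm_num
  have hg0 : ∀ p, blkBK i c p ∉ Sc → 1 - f p = 0 := fun p hp => by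
    have : blkBK i c p ∈ Sf := by
      by_contra h
      exact hp ((hmemSc _).2 fun hz => h ((hmemSf _).2 hz))
    simp only [hf, if_pos this, sub_self]
  have hm1 : ∀ p, |m p| ≤ 1 := fun p => abs_chi_sub_one_le_one i c p
  have hm0 : ∀ p, blkBK i c p ∉ Finset.univ \ nearN i c → m p = 0 := fun p hp => chi_sub_one_eq_zero_of_not_mem_sdiff i c p hp
  have hsep : ∀ a ∈ Sf, ∀ y ∈ Finset.univ \ nearN i c, ((toKT i).Mh : ℝ) ≤ (geoCK i c).dist a y := fun a ha y hy => by
    obtain ⟨z, hz, hne⟩ := (hmemSf a).1 ha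
    exact Mh_le_dist_of_hTY_ne_zero i c hz hne (Finset.mem_sdiff.1 hy).2
  -- rows meeting `supp h_□`: the separated engine
  have hA := sepMiddle_majorant_blk (R := Rr) (H := H) (blkBK i c) dB δ₀ aP αst asep ρ bG KP BG Λ ((toKT i).Mh : ℝ)
    (fun a => ((geoCK i c).len a ^ 2)⁻¹) (fun a => (geoCK i c).len a ^ 2) (fun a => (geoCK i c).len a ^ 2) Sf (Finset.univ \ nearN i c) f m
    hKP hBG hΛ hℓ2i hℓ2 hℓ2 hδ₀ hasep hρ hsplit htri hsymm hdnn hST h261 hf1 hf0 hm1 hm0 hsep hP hG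
  -- the other rows: the flat engine
  have hB := sepMiddle_majorant_blk₀ (R := Rr) (H := H) (blkBK i c) dB δ₀ aP αst asep ρ bG KP BG Λ
    (fun a => ((geoCK i c).len a ^ 2)⁻¹) (fun a => (geoCK i c).len a ^ 2) (fun a => (geoCK i c).len a ^ 2) Sc (Finset.univ \ nearN i c)
    (fun p => 1 - f p) m
    hKP hBG hΛ hℓ2i hℓ2 hℓ2 hδ₀ hasep hρ hsplit htri hsymm hdnn hST h261 hg1 hg0 hm1 hm0 hP hG
  have hsum := hasMajorant_add (g := toB6 (geoCK i c) Rr H) (blkBK i c) hA hB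
  rw [← add_mul, ← add_mul, ← add_mul, mulOp_add_eq_one, one_mul, ← conj_core_E_eq] at hsum
  refine hasMajorant_mono (g := toB6 (geoCK i c) Rr H) _ hsum fun a b' => le_of_eq ?_
  have hw : ((geoCK i c).len a ^ 2)⁻¹ * (geoCK i c).len a ^ 2 = 1 := inv_mul_cancel₀ (pow_ne_zero 2 (geoCK_len_pos i c a).ne')
  simp only [hSf, hSc, Finset.mem_filter, Finset.mem_univ, true_and, hw]
  by_cases ha : ∃ z : SiteY i, blkCubeY i c z = a ∧ hTY i c z ≠ 0
  · simp only [ha, not_true_eq_false, ↓reduceIte]; ring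
  · simp only [ha, not_false_eq_true, ↓reduceIte]; ring

open Classical in
set_option maxHeartbeats 1600000 in
/-- ★★ **THE CUBE-SIDE MAJORANT OF THE CORE OF `E♯_□`** (the factors reversed): `GVK(Ṽ) ≺ B_G·ℓ_□(a)²·e^{−b_G·δ₀·d_□}` on the left (`hG`), `conj b(DP_□D*(Ṽ)) ≺
K_P·ℓ_□(y)⁻²·e^{−a_P·δ₀·d_□}` on the right (`hP`), (2.61) at `a_P − ρ`, the scale transfer of `ℓ_□⁻²` at `α_st`, `α_st + a_sep + ρ ≦ b_G` ⟹
`conj b(G_□(Ṽ)·(M_{χ_□} − 1)·DP_□D*(Ṽ)) ≺ (B_GK_PΛ·c₁(δ₀, a_P − ρ)·[e^{−a_sep·δ₀·M_h} on the rows meeting supp h_□, else 1])·e^{−ρδ₀d_□(a,b′)}`.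
[cite: Balaban1985BackgroundPropagators, p.411 l.12–14, p.412 l.31–36, (3.105) p.414, (3.87) p.409, Cor. 3.6 p.408; Balaban1984PropagatorsII, (2.83)–(2.85) pp.237–238, (2.52)–(2.55) p.232, Lemma 2.1 (2.61) p.234] -/
theorem hasMajorant_core_ET (V : CfgY 𝔸 i) (Rr : ℝ) (H : Prop) (dB : ℕ) {δ₀ aP bG αst asep ρ KP BG Λ : ℝ}
    (hδ₀ : 0 ≤ δ₀) (hKP : 0 ≤ KP) (hBG : 0 ≤ BG) (hΛ : 0 ≤ Λ) (hasep : 0 ≤ asep) (hρ : 0 ≤ ρ) (hsplit : αst + asep + ρ ≤ bG)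
    (h261 : Ineq261 dB (toB6 (geoCK i c) Rr H) δ₀ (aP - ρ)) (hST : ScaleTransfer (geoCK i c) δ₀ αst Λ (fun a => ((geoCK i c).len a ^ 2)⁻¹))
    (hG : HasMajorant (g := toB6 (geoCK i c) Rr H) (blkBK i c) (GVK b i c parS parB V)
      (fun a y => BG * (geoCK i c).len a ^ 2 * Real.exp (-(bG * δ₀ * (geoCK i c).dist a y))))
    (hP : HasMajorant (g := toB6 (geoCK i c) Rr H) (blkBK i c) (conj b ((DPDsCubeY i c parS V).restrictScalars ℝ))
      (fun y b' => KP * ((geoCK i c).len y ^ 2)⁻¹ * Real.exp (-(aP * δ₀ * (geoCK i c).dist y b')))) :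
    HasMajorant (g := toB6 (geoCK i c) Rr H) (blkBK i c)
      (conj b ((GACubeY i c parS parB V * (cutMulY (𝔸 := 𝔸) (hBdY i (chiY i c)) - 1) * DPDsCubeY i c parS V).restrictScalars ℝ))
      (fun a b' => (if ∃ z : SiteY i, blkCubeY i c z = a ∧ hTY i c z ≠ 0
          then BG * KP * Λ * B6.c1 dB δ₀ (aP - ρ) * Real.exp (-(asep * δ₀ * (toKT i).Mh)) else BG * KP * Λ * B6.c1 dB δ₀ (aP - ρ)) *
        Real.exp (-(ρ * δ₀ * (geoCK i c).dist a b'))) := by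
  obtain ⟨hdnn, htri, -, hsymm⟩ := geoCK_dist_axioms i c Rr H
  have hℓ2 : ∀ a : BlkCubeY i c, 0 ≤ (geoCK i c).len a ^ 2 := fun a => sq_nonneg _
  have hℓ2i : ∀ a : BlkCubeY i c, 0 ≤ ((geoCK i c).len a ^ 2)⁻¹ := fun a => inv_nonneg.2 (hℓ2 a)
  set Sf : Finset (BlkCubeY i c) := Finset.univ.filter fun s => ∃ z : SiteY i, blkCubeY i c z = s ∧ hTY i c z ≠ 0 with hSf
  have hmemSf : ∀ s, s ∈ Sf ↔ ∃ z : SiteY i, blkCubeY i c z = s ∧ hTY i c z ≠ 0 := fun s => by simp [hSf]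
  set Sc : Finset (BlkCubeY i c) := Finset.univ.filter fun s => ¬ ∃ z : SiteY i, blkCubeY i c z = s ∧ hTY i c z ≠ 0 with hSc
  have hmemSc : ∀ s, s ∈ Sc ↔ ¬ ∃ z : SiteY i, blkCubeY i c z = s ∧ hTY i c z ≠ 0 := fun s => by simp [hSc]
  set f : FBondY i × ι → ℝ := fun p => if blkBK i c p ∈ Sf then 1 else 0 with hf
  set m : FBondY i × ι → ℝ := fun p => hBdY i (chiY i c) p.1 - 1 with hm
  have hf1 : ∀ p, |f p| ≤ 1 := fun p => by simp only [hf]; split_ifs <;> norm_num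
  have hf0 : ∀ p, blkBK i c p ∉ Sf → f p = 0 := fun p hp => by simp only [hf, if_neg hp]
  have hg1 : ∀ p, |1 - f p| ≤ 1 := fun p => by simp only [hf]; split_ifs <;> norm_num
  have hg0 : ∀ p, blkBK i c p ∉ Sc → 1 - f p = 0 := fun p hp => by
    have : blkBK i c p ∈ Sf := by
      by_contra h
      exact hp ((hmemSc _).2 fun hz => h ((hmemSf _).2 hz))
    simp only [hf, if_pos this, sub_self]
  have hm1 : ∀ p, |m p| ≤ 1 := fun p => abs_chi_sub_one_le_one i c p
  have hm0 : ∀ p, blkBK i c p ∉ Finset.univ \ nearN i c → m p = 0 := fun p hp => chi_sub_one_eq_zero_of_not_mem_sdiff i c p hp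
  have hsep : ∀ a ∈ Sf, ∀ y ∈ Finset.univ \ nearN i c, ((toKT i).Mh : ℝ) ≤ (geoCK i c).dist a y := fun a ha y hy => by
    obtain ⟨z, hz, hne⟩ := (hmemSf a).1 ha
    exact Mh_le_dist_of_hTY_ne_zero i c hz hne (Finset.mem_sdiff.1 hy).2
  have hA := sepMiddle_majorant_blk (R := Rr) (H := H) (blkBK i c) dB δ₀ bG αst asep ρ aP BG KP Λ ((toKT i).Mh : ℝ)
    (fun a => (geoCK i c).len a ^ 2) (fun a => ((geoCK i c).len a ^ 2)⁻¹) (fun a => ((geoCK i c).len a ^ 2)⁻¹) Sf (Finset.univ \ nearN i c) f m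
    hBG hKP hΛ hℓ2 hℓ2i hℓ2i hδ₀ hasep hρ hsplit htri hsymm hdnn hST h261 hf1 hf0 hm1 hm0 hsep hG hP
  have hB := sepMiddle_majorant_blk₀ (R := Rr) (H := H) (blkBK i c) dB δ₀ bG αst asep ρ aP BG KP Λ
    (fun a => (geoCK i c).len a ^ 2) (fun a => ((geoCK i c).len a ^ 2)⁻¹) (fun a => ((geoCK i c).len a ^ 2)⁻¹) Sc (Finset.univ \ nearN i c)
    (fun p => 1 - f p) m
    hBG hKP hΛ hℓ2 hℓ2i hℓ2i hδ₀ hasep hρ hsplit htri hsymm hdnn hST h261 hg1 hg0 hm1 hm0 hG hP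
  have hsum := hasMajorant_add (g := toB6 (geoCK i c) Rr H) (blkBK i c) hA hB
  rw [← add_mul, ← add_mul, ← add_mul, mulOp_add_eq_one, one_mul, ← conj_core_ET_eq] at hsum
  refine hasMajorant_mono (g := toB6 (geoCK i c) Rr H) _ hsum fun a b' => le_of_eq ?_
  have hw : (geoCK i c).len a ^ 2 * ((geoCK i c).len a ^ 2)⁻¹ = 1 := mul_inv_cancel₀ (pow_ne_zero 2 (geoCK_len_pos i c a).ne')
  simp only [hSf, hSc, Finset.mem_filter, Finset.mem_univ, true_and, hw]
  by_cases ha : ∃ z : SiteY i, blkCubeY i c z = a ∧ hTY i c z ≠ 0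
  · simp only [ha, not_true_eq_false, ↓reduceIte]; ring
  · simp only [ha, not_false_eq_true, ↓reduceIte]; ring

end Core

/-! ## §4  The member-side majorants of `conj b(E_□)`, `conj b(E♯_□)` (§3 fed to D1) -/

section Member

variable (i : KIdx d ℓ hd hL b₀ b₁) (c : ↥(cubes (toKT i).D.toDomains)) (parS : SiteParY 𝔸 i) (parB : BondParY 𝔸 i) (b : Module.Basis ι ℝ 𝔸)

open Classical in
set_option maxHeartbeats 1600000 in
/-- ★★★ **THE MEMBER-SIDE MAJORANT OF THE DEFECT `E_□` OF THE BOND-SECTOR CUBE LETTER** (M5.1b-G item 2 per cube, modulo `hP` and the cover sum): under the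
data of `hasMajorant_core_E` and a bi-contractive gauge `u` (`‖u‖, ‖u⁻¹‖ ≦ 1`),
`conj b(E_□(u, χ_□, h_□; Ṽ)) ≺ (M₂Σ‖b_j‖)²·𝟙_□(a)·(K_PB_GΛc₁(δ₀, b_G − ρ)·e^{−a_sep·δ₀·M_h})·e^{−ρδ₀·d(a,a′)}` over the member's `(toB6 (geo9K i) Rr′ Hp, ιB∘blkV1)`,
`𝟙_□(a)` = the ROW INDICATOR «the member block `a` holds a bond whose cube block meets `supp h_□`» (kept for the cover sum of D3, r03's `hasMajorant_localSum`) —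
the separation smallness `e^{−a_sep·δ₀·M_h}` of p. 411 ∕ p. 412 survives because D1 reads the cube kernel only on the rows meeting `supp h_□`, and
`d ≦ d_□` there (p38's `dist_member_le_dist_cube`).
[cite: Balaban1985BackgroundPropagators, (3.105) p.414, (3.87) p.409, p.411 l.12–14, p.412 l.31–36, Cor. 3.6 p.408; Balaban1984PropagatorsII, (2.83)–(2.85) pp.237–238, (2.51)–(2.55) p.232, Lemma 2.1 (2.61) p.234] -/
theorem hasMajorant_conj_locDefectBY {M₂ : ℝ} (hM₂ : 0 ≤ M₂) (hrepr : ∀ (v : 𝔸) (j : ι), |b.repr v j| ≤ M₂ * ‖v‖)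
    (g : GaugeY 𝔸 i) (hg : ∀ x, ‖((g x : 𝔸ˣ) : 𝔸)‖ ≤ 1 ∧ ‖(((g x)⁻¹ : 𝔸ˣ) : 𝔸)‖ ≤ 1) (V : CfgY 𝔸 i)
    (ιB : BlkY i → IBondY i) (hι : ∀ s, β i.hN i.D i.hk (ιB s) = s) (Rr : ℝ) (H : Prop) [Fintype (geo9K i).Site] (Rr' : ℝ) (Hp : Prop)
    (dB : ℕ) {δ₀ aP bG αst asep ρ KP BG Λ : ℝ}
    (hδ₀ : 0 ≤ δ₀) (hKP : 0 ≤ KP) (hBG : 0 ≤ BG) (hΛ : 0 ≤ Λ) (hasep : 0 ≤ asep) (hρ : 0 ≤ ρ) (hsplit : αst + asep + ρ ≤ aP)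
    (h261 : Ineq261 dB (toB6 (geoCK i c) Rr H) δ₀ (bG - ρ)) (hST : ScaleTransfer (geoCK i c) δ₀ αst Λ (fun a => (geoCK i c).len a ^ 2))
    (hP : HasMajorant (g := toB6 (geoCK i c) Rr H) (blkBK i c) (conj b ((DPDsCubeY i c parS V).restrictScalars ℝ))
      (fun a y => KP * ((geoCK i c).len a ^ 2)⁻¹ * Real.exp (-(aP * δ₀ * (geoCK i c).dist a y))))
    (hG : HasMajorant (g := toB6 (geoCK i c) Rr H) (blkBK i c) (GVK b i c parS parB V)
      (fun y b' => BG * (geoCK i c).len y ^ 2 * Real.exp (-(bG * δ₀ * (geoCK i c).dist y b')))) :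
    HasMajorant (g := toB6 (geo9K i) Rr' Hp) (fun p : FBondY i × ι => ιB (blkV1 i.hN i.D p.1))
      (conj b ((locDefectBY i c parS parB g (chiY i c) (hTY i c) V).restrictScalars ℝ))
      (fun a a' => (M₂ * ∑ j, ‖b j‖) ^ 2 *
        ((if ∃ x : FBondY i, ιB (blkOf i.D.toDomains (chartY i x.src)) = a ∧
              ∃ z : SiteY i, blkCubeY i c z = blkCubeY i c (chartY i x.src) ∧ hTY i c z ≠ 0
            then KP * BG * Λ * B6.c1 dB δ₀ (bG - ρ) * Real.exp (-(asep * δ₀ * (toKT i).Mh)) else 0) *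
          Real.exp (-(ρ * δ₀ * (geo9K i).dist a a')))) := by
  have hκ : 0 ≤ KP * BG * Λ * B6.c1 dB δ₀ (bG - ρ) * Real.exp (-(asep * δ₀ * (toKT i).Mh)) :=
    mul_nonneg (mul_nonneg (mul_nonneg (mul_nonneg hKP hBG) hΛ) (c1_nonneg _ _ _)) (Real.exp_nonneg _)
  refine hasMajorant_conj_locDefectBY_of_core i c parS parB b hM₂ hrepr g hg V ιB hι Rr H Rr' Hp
    (fun a a' => mul_nonneg (by split_ifs <;> [exact hκ; exact le_rfl]) (Real.exp_nonneg _)) (fun x x₀ hx _ => ?_)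
    (hasMajorant_core_E i c parS parB b V Rr H dB hδ₀ hKP hBG hΛ hasep hρ hsplit h261 hST hP hG)
  have hdD := dist_member_le_dist_cube i c ιB hι (chartY i x.src) (chartY i x₀.src)
  have hρδ : 0 ≤ ρ * δ₀ := mul_nonneg hρ hδ₀
  rw [if_pos hx, if_pos ⟨x, rfl, hx⟩]
  exact mul_le_mul_of_nonneg_left (Real.exp_le_exp.2 (by nlinarith)) hκ

open Classical in
set_option maxHeartbeats 1600000 in
/-- ★★★ **THE MEMBER-SIDE MAJORANT OF THE DEFECT `E♯_□`** (core reversed; the data of `hasMajorant_core_ET`):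
`conj b(E♯_□(u, χ_□, h_□; Ṽ)) ≺ (M₂Σ‖b_j‖)²·𝟙_□(a)·(B_GK_PΛc₁(δ₀, a_P − ρ)·e^{−a_sep·δ₀·M_h})·e^{−ρδ₀·d(a,a′)}` over the member's geometry (same row indicator).
[cite: Balaban1985BackgroundPropagators, (3.105) p.414, (3.87) p.409, p.411 l.12–14, p.412 l.31–36, Cor. 3.6 p.408; Balaban1984PropagatorsII, (2.83)–(2.85) pp.237–238, (2.51)–(2.55) p.232, Lemma 2.1 (2.61) p.234] -/
theorem hasMajorant_conj_locDefectTBY {M₂ : ℝ} (hM₂ : 0 ≤ M₂) (hrepr : ∀ (v : 𝔸) (j : ι), |b.repr v j| ≤ M₂ * ‖v‖)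
    (g : GaugeY 𝔸 i) (hg : ∀ x, ‖((g x : 𝔸ˣ) : 𝔸)‖ ≤ 1 ∧ ‖(((g x)⁻¹ : 𝔸ˣ) : 𝔸)‖ ≤ 1) (V : CfgY 𝔸 i)
    (ιB : BlkY i → IBondY i) (hι : ∀ s, β i.hN i.D i.hk (ιB s) = s) (Rr : ℝ) (H : Prop) [Fintype (geo9K i).Site] (Rr' : ℝ) (Hp : Prop)
    (dB : ℕ) {δ₀ aP bG αst asep ρ KP BG Λ : ℝ}
    (hδ₀ : 0 ≤ δ₀) (hKP : 0 ≤ KP) (hBG : 0 ≤ BG) (hΛ : 0 ≤ Λ) (hasep : 0 ≤ asep) (hρ : 0 ≤ ρ) (hsplit : αst + asep + ρ ≤ bG)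
    (h261 : Ineq261 dB (toB6 (geoCK i c) Rr H) δ₀ (aP - ρ)) (hST : ScaleTransfer (geoCK i c) δ₀ αst Λ (fun a => ((geoCK i c).len a ^ 2)⁻¹))
    (hG : HasMajorant (g := toB6 (geoCK i c) Rr H) (blkBK i c) (GVK b i c parS parB V)
      (fun a y => BG * (geoCK i c).len a ^ 2 * Real.exp (-(bG * δ₀ * (geoCK i c).dist a y))))
    (hP : HasMajorant (g := toB6 (geoCK i c) Rr H) (blkBK i c) (conj b ((DPDsCubeY i c parS V).restrictScalars ℝ))
      (fun y b' => KP * ((geoCK i c).len y ^ 2)⁻¹ * Real.exp (-(aP * δ₀ * (geoCK i c).dist y b')))) :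
    HasMajorant (g := toB6 (geo9K i) Rr' Hp) (fun p : FBondY i × ι => ιB (blkV1 i.hN i.D p.1))
      (conj b ((locDefectTBY i c parS parB g (chiY i c) (hTY i c) V).restrictScalars ℝ))
      (fun a a' => (M₂ * ∑ j, ‖b j‖) ^ 2 *
        ((if ∃ x : FBondY i, ιB (blkOf i.D.toDomains (chartY i x.src)) = a ∧
              ∃ z : SiteY i, blkCubeY i c z = blkCubeY i c (chartY i x.src) ∧ hTY i c z ≠ 0
            then BG * KP * Λ * B6.c1 dB δ₀ (aP - ρ) * Real.exp (-(asep * δ₀ * (toKT i).Mh)) else 0) *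
          Real.exp (-(ρ * δ₀ * (geo9K i).dist a a')))) := by
  have hκ : 0 ≤ BG * KP * Λ * B6.c1 dB δ₀ (aP - ρ) * Real.exp (-(asep * δ₀ * (toKT i).Mh)) :=
    mul_nonneg (mul_nonneg (mul_nonneg (mul_nonneg hBG hKP) hΛ) (c1_nonneg _ _ _)) (Real.exp_nonneg _)
  refine hasMajorant_conj_locDefectTBY_of_core i c parS parB b hM₂ hrepr g hg V ιB hι Rr H Rr' Hp
    (fun a a' => mul_nonneg (by split_ifs <;> [exact hκ; exact le_rfl]) (Real.exp_nonneg _)) (fun x x₀ hx _ => ?_)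
    (hasMajorant_core_ET i c parS parB b V Rr H dB hδ₀ hKP hBG hΛ hasep hρ hsplit h261 hST hG hP)
  have hdD := dist_member_le_dist_cube i c ιB hι (chartY i x.src) (chartY i x₀.src)
  have hρδ : 0 ≤ ρ * δ₀ := mul_nonneg hρ hδ₀
  rw [if_pos hx, if_pos ⟨x, rfl, hx⟩]
  exact mul_le_mul_of_nonneg_left (Real.exp_le_exp.2 (by nlinarith)) hκ

end Member

end Literature.MathematicalPhysics.QuantumFieldTheory.Balaban1983to89.B9Cor36GCubeLocDefectCore

end
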